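import Mathlib
import HarnessLib
import Summits.AtomisticToContinuum.BoseEinsteinCondensation.Theses.BECThomsonPrinciple

/-!
# Sketch — crux idea `sine-basis-kls-bypass` for PeriodicToDirichlet (stmt-AtomisticToContinuum-9483)

First lemmas of the line "run Gaussian domination + Kennedy–Lieb–Shastry natively in the Dirichlet
box, in the sine eigenbasis of the Dirichlet Laplacian": the chord inequality `GDDirichletSine`
(the Dirichlet twin of the route's `GaussianDominationCan`, typed over `TrialState`/`energy`/
`groundStateEnergy` with the sine-mode excitation operator `Λ^s_n† = Σ_i |s_n⟩⟨s_0|_i n̂₀^{-1/2}`),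
the KLS output `SineModeOccupation` (macroscopic occupation of the lowest sine mode by every
near-minimiser of the Dirichlet energy), and the composition concluding the crux BY NAME.
-/

noncomputable section

namespace Summit.AtomisticToContinuum.BoseEinsteinCondensation.Cruxes.PeriodicToDirichlet.SineBasisKLS

open MeasureTheory Literature.MathematicalPhysics.QuantumManyBody.BoseGas
open scoped ENNReal ComplexConjugate

/-- The `L²`-normalised Dirichlet sine mode `s_n(x) = (2/L)^{3/2} ∏_α sin(π (n_α+1) x_α / L)` of
the box `(0,L)³` (extended by `0`), `n : Fin 3 → ℕ`; `s_0` is the one-particle Dirichlet ground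
state, eigenvalue `ε_n = (π/L)² Σ_α (n_α+1)²`. -/
def sineMode (L : ℝ) (n : Fin 3 → ℕ) : Space → ℂ :=
  (box L).indicator fun x =>
    (((Real.sqrt (2 / L)) ^ 3 * ∏ α : Fin 3, Real.sin (Real.pi * ((n α : ℝ) + 1) * x α / L) : ℝ) : ℂ)

/-- The kinetic gap `ε_n − ε_0 = (π/L)² (Σ_α (n_α+1)² − 3)` of the sine mode `s_n`. -/
def sineGap (L : ℝ) (n : Fin 3 → ℕ) : ℝ :=
  (Real.pi / L) ^ 2 * ((∑ α : Fin 3, ((n α : ℝ) + 1) ^ 2) - 3)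

/-- **C⁺ (transfer target). Dirichlet Gaussian domination in the sine basis, chord form.**
For every repulsive finite-range `v` and window parameter `M` there are `ρ₀, C, N₀` with: for
`N ≥ N₀` bosons in the Dirichlet box of side `L` at density `N/L³ ≤ ρ₀`, every sine mode
`n ≠ 0` in the window `ε_n − ε_0 ≤ M² N/L³`, every `s ≥ 0` and every Dirichlet trial state `Φ`,
`E₀^D(N,L) + 2s |⟨Φ, Λ^s_n† Φ⟩| ≤ energy(Φ) + C s²/(ε_n − ε_0)`, where
`Λ^s_n† = Σ_i |s_n⟩⟨s_0|_i n̂₀^{-1/2}` (`P_i` = projection of particle `i` onto `s_0`,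
`n̂₀ = Σ_i P_i`, `n̂₀^{-1/2} = Σ_S |S|^{-1/2} ∏_{i∈S} P_i ∏_{i∉S} (1−P_i)`), written in configuration
space exactly as in the route's `GaussianDominationCan` with `cell/cellN/e^{ik·x₀}` replaced by
`box/boxN/s_n(x₀)⟨s_0|`. Free gas: equality with `C = 1` (displaced oscillator in the two-mode
sector `(s_0, s_n)`). -/
def GDDirichletSine : Prop :=
  ∀ v : ℝ → ℝ≥0∞, IsRepulsiveFiniteRange v → ∀ M : ℝ, 0 < M → ∃ ρ₀ C : ℝ, 0 < ρ₀ ∧ 0 < C ∧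
    ∃ N₀ : ℕ, ∀ m : ℕ, N₀ ≤ m + 1 → ∀ L : ℝ, 0 < L → ((m + 1 : ℕ) : ℝ) ≤ ρ₀ * L ^ 3 →
    ∀ n : Fin 3 → ℕ, n ≠ 0 → sineGap L n ≤ M ^ 2 * (((m + 1 : ℕ) : ℝ) / L ^ 3) →
    ∀ s : ℝ, 0 ≤ s → ∀ Φ : TrialState (m + 1) L,
    let P : Fin (m + 1) → (Config (m + 1) → ℂ) → (Config (m + 1) → ℂ) := fun i g X =>
      sineMode L 0 (X i) * ∫ y in box L, conj (sineMode L 0 y) * g (Function.update X i y)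
    let Q : Finset (Fin (m + 1)) → (Config (m + 1) → ℂ) → (Config (m + 1) → ℂ) := fun S g =>
      (List.finRange (m + 1)).foldr (fun i h => if i ∈ S then P i h else h - P i h) g
    let Θ : Config (m + 1) → ℂ := fun X =>
      ∑ S ∈ (Finset.univ : Finset (Finset (Fin (m + 1)))).filter (fun S => (0 : Fin (m + 1)) ∈ S),
        ((Real.sqrt (S.card : ℝ))⁻¹ : ℂ) * Q S Φ.ψ X
    groundStateEnergy v (m + 1) L +
        ENNReal.ofReal (s * (2 * (m + 1) *
          ‖∫ X in boxN (m + 1) L, conj (Φ.ψ X) *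
              (sineMode L n (X 0) * ∫ y in box L, conj (sineMode L 0 y) * Θ (Function.update X 0 y))‖))
      ≤ energy v Φ + ENNReal.ofReal (C * s ^ 2 / sineGap L n)

/-- **KLS output in the box.** Macroscopic occupation of the lowest sine mode `s_0` by every
`δ`-near-minimiser of the Dirichlet energy, at all small densities (the Dirichlet twin of the
route's `PeriodicBEC`, with the constant mode replaced by `s_0`). -/
def SineModeOccupation : Prop :=
  ∀ v : ℝ → ℝ≥0∞, IsRepulsiveFiniteRange v → ∃ ρ₀ : ℝ, 0 < ρ₀ ∧ ∀ ρ : ℝ, 0 < ρ → ρ < ρ₀ →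
    ∃ c : ℝ, 0 < c ∧ ∀ᶠ N : ℕ in Filter.atTop, ∃ δ : ℝ≥0∞, 0 < δ ∧
      ∀ Ψ : TrialState N (sideLength ρ N),
        energy v Ψ ≤ groundStateEnergy v N (sideLength ρ N) + δ →
          ENNReal.ofReal (c * N) ≤ occupation N (sineMode (sideLength ρ N) 0) Ψ.ψ

/-- **First lemma of the line (the Dirichlet KLS transfer; mirror of the route's `GDTransfer`).**
`GDDirichletSine → SineModeOccupation`: KLS run variationally at a `δ`-near-minimiser `Ψ` with
`ζ = (Λ^s_n + Λ^s_n†)Ψ` — admissible (vanishes on the walls) and with ZERO first variation at the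
Dirichlet eigenfunction — gives `n_{s_n} ≤ √(2C)(1 + √(C'ρ)/√(ε_n−ε_0))` in the window; kinetic
Chebyshev above the window uses `energy ≤ E₀^D + δ ≤ 4πaρN(1+o(1))` (LSSY upper bound + the PROVED
b.c.-independence of `e₀`); Parseval in the sine basis closes. -/
def KLSDirichlet : Prop := GDDirichletSine → SineModeOccupation

/-- **Support (provable now, like `bec_of_zeroMode`).** `s_0` is measurable and `L²`-normalised, so
`occupation N s_0 Ψ ≤ maxOccupation N Ψ` and `le_condensateNumber` give the conjunct. -/
def SineToBEC : Prop := SineModeOccupation → _root_.BoseEinsteinCondensation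

/-- The composition concluding the crux BY NAME: the hypothesis `PeriodicBEC` of
`PeriodicToDirichlet` is not consumed — the line proves the Dirichlet conjunct natively. -/
theorem periodicToDirichlet_of (h₁ : GDDirichletSine) (h₂ : KLSDirichlet) (h₃ : SineToBEC) :
    Summit.AtomisticToContinuum.BoseEinsteinCondensation.Theses.BECThomsonPrinciple.PeriodicToDirichlet :=
  fun _ => h₃ (h₂ h₁)

end Summit.AtomisticToContinuum.BoseEinsteinCondensation.Cruxes.PeriodicToDirichlet.SineBasisKLS

end
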